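import Summits.BirchSwinnertonDyer.BirchSwinnertonDyer.Theorems.ErratumRoadFiveJSWControlMultOfFacts
import Summits.BirchSwinnertonDyer.BirchSwinnertonDyer.Theorems.SchneiderFreeAdditiveX3PoitouTateSelmerDualityHolds
import Summits.BirchSwinnertonDyer.BirchSwinnertonDyer.Theorems.ThetaPartnerAtTwoSignedControlAtTwoStubPoitouTateShaRat
import HarnessLib

set_option linter.dupNamespace false -- `…BirchSwinnertonDyer.BirchSwinnertonDyer…` is the nested layout (D-0017)
set_option autoImplicit false

/-!
# Jetchev–Skinner–Wan 2017 Thm. 3.3.1 at a multiplicative prime, AS TYPED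
# (`JetchevSkinnerWan2017.thm331_anticyclotomicControl_mult`, item 19626), is a THEOREM OF THE TREE — hypothesis-free, ROUTE-FREE
# (LADDER-BSD D-0154 (2) INPUTS; desk `pub/bsd-wall/bsd-inputs`; route `ErratumRoadFive`, cell `bsd-stepL`)

Seat `bsd-inputs-honda-p1` (gen 8, idle INPUTS prover), `--supports stmt-BirchSwinnertonDyer-19626`. THEOREMS ONLY (no definition, no
named fact, no `sorry`); no new mathematics — a one-line composition; this module imports NO route file (`Theses.*`), so the 90-odd
`Theorems/ErratumRoadFive*` files carrying a binder `(h331 : thm331_anticyclotomicControl_mult)` can discharge it by importing this module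
without entering the route's rebuild cone.

The chain (all landed): `bsd-stepL-imc-p1` g16 proved
`JSWControl.thm331_anticyclotomicControl_mult_of_poitouTate (hPT : ∀ K, poitouTate_selmerStructure_duality K)
(hPT2 : ∀ K, poitouTate_sha_tateDual K) : JetchevSkinnerWan2017.thm331_anticyclotomicControl_mult`
(`Theorems/ErratumRoadFiveJSWControlMultOfFacts.lean`, p596255: the tree's kernel control theorem — Mazur control, Greenberg's Lemma 4.2,
the rank-one any-torsion base count, Brink Thm. 2, Milne I 2.8, `cd_p ≤ 2` — re-assembled on JSW's own hypotheses, conditional ONLY on the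
two classical Poitou–Tate inputs taken by name). Both inputs are, since 2026-08-28, THEOREMS for every number field `K`:
`SchneiderFreeAdditiveX3.PoitouTateReduction.poitouTate_selmerStructure_duality_holds K` (Milne ADT I Thm. 4.10 (b) for Selmer
structures; cell `bsd-schneider`, p624636) and `SignedEC.PoitouTateShaRat.poitouTate_sha_tateDual_numberField K` (Milne ADT I
Thm. 4.10 (a) / Tate duality for `Ш` of a finite Galois module; cell `bsd-wall` K4, p629917). Hence the named fact holds with NO
hypothesis (§1).

Honest framing: JSW 2017 Thm. 3.3.1 (with §3.5 (3.5.c)) is a published theorem; what is proved here is the tree's TYPED statement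
`thm331_anticyclotomicControl_mult` (anticyclotomic control identity at a multiplicative `p ≥ 3`, `K` imaginary quadratic with `p` split,
`rank E(K) = 1`, `#Ш(E/K)[p^∞] < ∞`, any `ι` inducing the strict prime), whose in-tree proof was conditional only on the two Poitou–Tate
inputs; both are now kernel theorems, so the statement is UNCONDITIONAL AS TYPED. It is NOT a case of BSD; no crux of substance and no
summit statement is proved; item 19626 is an `aside` of route `ErratumRoadFive` (DROP-JSW, rev 42) and closing it moves no crux; the
Birch–Swinnerton-Dyer conjecture is NOT proved by any of this.
References: [JetchevSkinnerWan2017] Thm. 3.3.1 (arXiv:1512.06894 Thm. 8, p. 11), §3.5 (3.5.c) (p. 15); [MilneADT2006] Ch. I,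
Thm. 4.10 (a)(b); [Castella2018] proof of Thm. 2.3 (arXiv:1704.06608 p. 6).
-/

noncomputable section

namespace Summit.BirchSwinnertonDyer.BirchSwinnertonDyer.Theorems.JSWControl

open Literature.NumberTheory.GaloisCohomology Literature.NumberTheory.EllipticCurves

/-! ## §1 The named fact, hypothesis-free -/

/-- **Jetchev–Skinner–Wan 2017 Thm. 3.3.1 at a multiplicative prime — the named fact
`JetchevSkinnerWan2017.thm331_anticyclotomicControl_mult`, PROVED (no hypothesis, route-free):**
`thm331_anticyclotomicControl_mult_of_poitouTate` at the tree theorems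
`SchneiderFreeAdditiveX3.PoitouTateReduction.poitouTate_selmerStructure_duality_holds` (Poitou–Tate 4.10 (b), every number field,
p624636) and `SignedEC.PoitouTateShaRat.poitouTate_sha_tateDual_numberField` (Poitou–Tate 4.10 (a), every number field, p629917).
Unconditional AS TYPED; closes nothing by itself (route-free); BSD is not proved by this.
[cite: JetchevSkinnerWan2017, Thm. 3.3.1 (arXiv:1512.06894 Thm. 8, p. 11) with §3.5 (3.5.c) (p. 15)]
[cite: MilneADT2006, Ch. I, Thm. 4.10 (a)(b)] -/
theorem thm331_anticyclotomicControl_mult_holds : JetchevSkinnerWan2017.thm331_anticyclotomicControl_mult :=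
  thm331_anticyclotomicControl_mult_of_poitouTate
    (fun K _ _ => SchneiderFreeAdditiveX3.PoitouTateReduction.poitouTate_selmerStructure_duality_holds K)
    (fun K _ _ => SignedEC.PoitouTateShaRat.poitouTate_sha_tateDual_numberField K)

end Summit.BirchSwinnertonDyer.BirchSwinnertonDyer.Theorems.JSWControl

end
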